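import Mathlib
import HarnessLib
import Literature.Analysis.FluidPDE.VectorCalculus
import Literature.Analysis.FluidPDE.VorticityStretching
import Literature.Analysis.FluidPDE.HelmholtzAnnihilator
import Literature.Analysis.FluidPDE.NSBoundedSpatialHolder
import Literature.Analysis.FluidPDE.NewtonKernel
import Literature.Analysis.FluidPDE.VanishingVerticalVorticityPotentials
import Literature.Analysis.FluidPDE.TypeIAncientMildClassical
import Summits.NavierStokesRegularity.NavierStokesRegularity.Theorems.LocalSineTubeDoorProfileAlignedWindowRigidityAncient

/-!
# Route `PoloidalWindowDoor` (staged, nsreg-p1), crux `PoloidalWindowRigidity` (K2) — the horizontal vorticity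
# equation of a poloidal profile in Clebsch variables (nsreg-p1's (E2)), kernel-checked

Cell ns-regularity-ideate, seat p7 (lead on K2; route-directed support for the open stub `stub_nonflatLiouville`,
to be landed `--supports <PoloidalWindowRigidity item>` once the route is born). Companion of
`Theorems/PoloidalWindowDoorPoloidalWindowRigidityClebsch.lean` (slice potentials `φ`, `ψ = v₂ − ∂₂φ`,
`v = ∇φ + ψ e₂`, `curl v = ∇ψ × e₂`, (E1) `Δφ + ∂₂ψ = 0`, frozen constraint `{ψ, v₂}_h = 0`) over the tree files
`Literature/Analysis/FluidPDE/VanishingVerticalVorticityPotentials(Time).lean`.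

nsreg-p1's reduction of the poloidal Navier–Stokes system (ROUND-8 §8, R9-PREP §(1)) reads, in the variables
`(φ, ψ)`: (E1) `Δφ + ∂₃ψ = 0` and (E2) `d(v₃ dψ − T dx₃) = 0`, `T = ψ_s + v·∇ψ − Δψ`, i.e. the frozen constraint
plus `∇_h T = ∂₃ψ ∇_h v₃ − ∂₃v₃ ∇_h ψ`. (E1) and the frozen constraint are in the companion file; THIS file
kernel-checks (E2):

* GENERIC PART (`section Clebsch`, any smooth divergence-free `V : ℝ³ → ℝ³` with `(curl V)₂ ≡ 0`, `φ` its
  horizontal line potential, `ψ = V₂ − ∂₂φ`): the three terms of the horizontal vorticity operator in Clebsch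
  variables — transport `((V·∇)ω)₀ = ∂₁(V·∇ψ) − Dψ[∂₁V]` (`convect_curl_apply`), stretching
  `((ω·∇)V)ᵢ = ∂₁ψ (∂₀V)ᵢ − ∂₀ψ (∂₁V)ᵢ` (`convect_curl_self_apply`), diffusion `(Δω)₀ = ∂₁Δψ`
  (`laplacian_curl_apply`) — and their sum
  **`((V·∇)ω − (ω·∇)V − Δω)₀ = ∂₁(V·∇ψ − Δψ) − (∂₂ψ ∂₁V₂ − ∂₂V₂ ∂₁ψ)`**
  (`horizontalVorticityOperator_apply_zero`; index `1`: `…_apply_one`), the only input beyond calculus being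
  `div V = 0` (the coefficient of `∂ᵢψ` that survives is `−div V`); also `Δ_hφ = −∂₂V₂` (`horizLaplacian_phi`).
* CLASS PART (`section Profile`): for a profile of the route's Type-I class (rate, continuity on the slab,
  unit-viscosity Oseen-mild identity, divergence-free slices — EXACTLY the hypotheses of `stub_nonflatLiouville`)
  that is poloidal along `e₂`, the slices are classical Navier–Stokes solutions with a pressure on every window
  (`IsTypeIAncientMild.exists_isClassicalNSSolutionOn_Ioo`) and the tree's vorticity equation
  (`IsClassicalNSSolutionOn.curl_timeDerivWithin_eq`) gives **(E2)**:
  `(curl ∂ₜv)₀ + ∂₁(v·∇ψ − Δψ) = ∂₂ψ ∂₁v₂ − ∂₂v₂ ∂₁ψ`, `(curl ∂ₜv)₁ − ∂₀(v·∇ψ − Δψ) = −(∂₂ψ ∂₀v₂ − ∂₂v₂ ∂₀ψ)`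
  (`clebsch_vorticity_equation`; `∂ₜ` two-sided; with `curl ∂ₜv = ∇(∂ₜψ) × e₂` this is
  `∇_h(∂ₜψ + v·∇ψ − Δψ) = ∂₂ψ ∇_h v₂ − ∂₂v₂ ∇_h ψ`).

The OPEN content of the stub (a Liouville theorem for this system on the rotational non-flat stratum; census
HOME/ns-regularity-ideate-p7/CENSUS-K2G.md) is untouched. WHAT THIS IS NOT: not a claim about Navier–Stokes
regularity, not a proof of K2 — kernel bookkeeping for a STAGED door route (bears_on LADDER-NS N0).
-/

noncomputable section

-- the summit and its single sub-problem share the name (CONVENTIONS §1), as in every Theorems file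
set_option linter.dupNamespace false

namespace Summit.NavierStokesRegularity.NavierStokesRegularity.Theorems.PoloidalWindowDoorPoloidalWindowRigidityClebschVorticity

open Set Function
open scoped RealInnerProductSpace InnerProductSpace Laplacian ContDiff
open Literature.Analysis Literature.Analysis.FluidPDE
open Literature.Analysis.FluidPDE.VerticalVorticityFree

variable {V : EuclideanSpace ℝ (Fin 3) → EuclideanSpace ℝ (Fin 3)}

/-! ### Coordinate calculus -/
/-- Expansion of a continuous linear form in the standard coordinates: `ℓ w = Σₘ wₘ ℓ(eₘ)`. -/
theorem clf_apply_eq_sum3 (ℓ : EuclideanSpace ℝ (Fin 3) →L[ℝ] ℝ) (w : EuclideanSpace ℝ (Fin 3)) :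
    ℓ w = ∑ m, w m * ℓ (EuclideanSpace.single m 1) := by
  have hw : w = ∑ m, w m • (EuclideanSpace.single m (1 : ℝ) : EuclideanSpace ℝ (Fin 3)) := by
    simpa using ((EuclideanSpace.basisFun (Fin 3) ℝ).sum_repr w).symm
  conv_lhs => rw [hw]
  simp [map_sum, map_smul]

/-- Coordinates of a vector Laplacian: `(ΔV)ᵢ = Δ(Vᵢ)` for `V ∈ C²`. -/
theorem laplacian_apply_coord (hV : ContDiff ℝ 2 V) (x : EuclideanSpace ℝ (Fin 3)) (i : Fin 3) :
    (Δ V) x i = (Δ (fun y => V y i)) x := by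
  have h : (fun y => V y i) = (EuclideanSpace.proj i : EuclideanSpace ℝ (Fin 3) →L[ℝ] ℝ) ∘ V := rfl
  rw [h, ContDiffAt.laplacian_CLM_comp_left hV.contDiffAt]
  rfl

/-- Coordinates of the convective derivative of a vector field: `((a·∇)F)ᵢ = D(Fᵢ)(x)[a x]`. -/
theorem convect_apply_coord {a F : EuclideanSpace ℝ (Fin 3) → EuclideanSpace ℝ (Fin 3)}
    {x : EuclideanSpace ℝ (Fin 3)} (hF : DifferentiableAt ℝ F x) (i : Fin 3) :
    convect a F x i = fderiv ℝ (fun y => F y i) x (a x) := by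
  have h : (fun y => F y i) = (EuclideanSpace.proj i : EuclideanSpace ℝ (Fin 3) →L[ℝ] ℝ) ∘ F := rfl
  rw [convect_apply, h, fderiv_comp x (EuclideanSpace.proj i : EuclideanSpace ℝ (Fin 3) →L[ℝ] ℝ).differentiableAt hF,
    ContinuousLinearMap.fderiv]
  rfl

/-- `∂_w (y ↦ Dψ(y)[u]) = D²ψ(x)[w][u]` for `ψ ∈ C²` and a fixed vector `u`. -/
theorem fderiv_fderiv_apply_const {ψ : EuclideanSpace ℝ (Fin 3) → ℝ} (hψ : ContDiff ℝ 2 ψ)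
    (x u w : EuclideanSpace ℝ (Fin 3)) :
    fderiv ℝ (fun y => fderiv ℝ ψ y u) x w = fderiv ℝ (fderiv ℝ ψ) x w u := by
  have hd : DifferentiableAt ℝ (fderiv ℝ ψ) x :=
    ((hψ.fderiv_right (m := 1) le_rfl).differentiable one_ne_zero) x
  rw [fderiv_clm_apply hd (differentiableAt_const u)]
  simp

/-- **Product rule for `V·∇ψ`**: `∂_w (Dψ[V]) = D²ψ[w][V] + Dψ[DV w]`. -/
theorem fderiv_convect_scalar {ψ : EuclideanSpace ℝ (Fin 3) → ℝ} (hψ : ContDiff ℝ 2 ψ)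
    (hV : ContDiff ℝ 1 V) (x w : EuclideanSpace ℝ (Fin 3)) :
    fderiv ℝ (fun y => convect V ψ y) x w =
      fderiv ℝ (fderiv ℝ ψ) x w (V x) + fderiv ℝ ψ x (fderiv ℝ V x w) := by
  have hd : DifferentiableAt ℝ (fderiv ℝ ψ) x :=
    ((hψ.fderiv_right (m := 1) le_rfl).differentiable one_ne_zero) x
  have hVd : DifferentiableAt ℝ V x := (hV.differentiable one_ne_zero) x
  simp only [convect_apply]
  rw [fderiv_clm_apply hd hVd]
  simp only [_root_.add_apply, ContinuousLinearMap.coe_comp, comp_apply,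
    ContinuousLinearMap.flip_apply]
  ring

/-! ### The three terms of the horizontal vorticity operator in Clebsch variables -/
section Clebsch

variable (hV : ContDiff ℝ ∞ V) (hcurl : ∀ y, curl V y 2 = 0) {φ : EuclideanSpace ℝ (Fin 3) → ℝ}
  (hφ : φ = fun x : EuclideanSpace ℝ (Fin 3) =>
    ∫ σ in (0 : ℝ)..1, ⟪V (σ • (x - x 2 • (EuclideanSpace.single (2 : Fin 3) (1 : ℝ))) +
      x 2 • (EuclideanSpace.single (2 : Fin 3) (1 : ℝ))),
      x - x 2 • (EuclideanSpace.single (2 : Fin 3) (1 : ℝ))⟫_ℝ)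
include hV hcurl hφ

omit hcurl in
/-- The potential is smooth. -/
theorem contDiff_phi : ContDiff ℝ ∞ φ := by rw [hφ]; exact contDiff_linePotential hV

omit hcurl in
/-- The stream function `ψ = V₂ − ∂₂φ` is smooth. -/
theorem contDiff_stream : ContDiff ℝ ∞ fun y => V y 2 - fderiv ℝ φ y (EuclideanSpace.single 2 1) := by
  have hφs := contDiff_phi hV hφ
  exact ((EuclideanSpace.proj (2 : Fin 3) : EuclideanSpace ℝ (Fin 3) →L[ℝ] ℝ).contDiff.comp hV).sub
    ((hφs.fderiv_right (m := ∞) le_rfl).clm_apply contDiff_const)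

/-- The vorticity coordinates as FUNCTIONS: `(curl V)₀ = ∂₁ψ`, `(curl V)₁ = −∂₀ψ`. -/
theorem curl_coord_fun :
    (fun y => curl V y 0) = (fun y => fderiv ℝ (fun z => V z 2 - fderiv ℝ φ z (EuclideanSpace.single 2 1)) y
        (EuclideanSpace.single 1 1)) ∧
    (fun y => curl V y 1) = (fun y => -fderiv ℝ (fun z => V z 2 - fderiv ℝ φ z (EuclideanSpace.single 2 1)) y
        (EuclideanSpace.single 0 1)) :=
  ⟨funext fun y => (curl_apply_eq_fderiv_stream hV hcurl hφ y).1,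
    funext fun y => (curl_apply_eq_fderiv_stream hV hcurl hφ y).2.1⟩

/-- **Transport term**: `((V·∇)ω)₀ = ∂₁(V·∇ψ) − Dψ[∂₁V]` and `((V·∇)ω)₁ = −∂₀(V·∇ψ) + Dψ[∂₀V]`. -/
theorem convect_curl_apply (y : EuclideanSpace ℝ (Fin 3)) :
    convect V (curl V) y 0 =
      fderiv ℝ (fun z => convect V (fun z => V z 2 - fderiv ℝ φ z (EuclideanSpace.single 2 1)) z) y
          (EuclideanSpace.single 1 1) -
        fderiv ℝ (fun z => V z 2 - fderiv ℝ φ z (EuclideanSpace.single 2 1)) y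
          (fderiv ℝ V y (EuclideanSpace.single 1 1)) ∧
    convect V (curl V) y 1 =
      -fderiv ℝ (fun z => convect V (fun z => V z 2 - fderiv ℝ φ z (EuclideanSpace.single 2 1)) z) y
          (EuclideanSpace.single 0 1) +
        fderiv ℝ (fun z => V z 2 - fderiv ℝ φ z (EuclideanSpace.single 2 1)) y
          (fderiv ℝ V y (EuclideanSpace.single 0 1)) := by
  set ψ : EuclideanSpace ℝ (Fin 3) → ℝ := fun z => V z 2 - fderiv ℝ φ z (EuclideanSpace.single 2 1) with hψ
  have hψs : ContDiff ℝ ∞ ψ := contDiff_stream hV hφ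
  have hψ2 : ContDiff ℝ 2 ψ := hψs.of_le (by norm_cast)
  have hV1 : ContDiff ℝ 1 V := hV.of_le (by norm_cast)
  have hc1 : ContDiff ℝ (1 : ℕ∞) (curl V) :=
    contDiff_curl (n := 1) (hV.of_le (by norm_cast))
  have hcd : DifferentiableAt ℝ (curl V) y := (hc1.differentiable (by simp)) y
  obtain ⟨hc0, hc1⟩ := curl_coord_fun hV hcurl hφ
  refine ⟨?_, ?_⟩
  · rw [convect_apply_coord hcd 0, hc0, fderiv_fderiv_apply_const hψ2,
      fderiv_convect_scalar hψ2 hV1]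
    have hsym := (hψ2.contDiffAt (x := y)).isSymmSndFDerivAt (by simp)
      (V y) (EuclideanSpace.single 1 1)
    rw [hsym]; ring
  · rw [convect_apply_coord hcd 1, hc1, fderiv_fun_neg, _root_.neg_apply,
      fderiv_fderiv_apply_const hψ2, fderiv_convect_scalar hψ2 hV1]
    have hsym := (hψ2.contDiffAt (x := y)).isSymmSndFDerivAt (by simp)
      (V y) (EuclideanSpace.single 0 1)
    rw [hsym]; ring

/-- **Stretching term**: `((ω·∇)V)ᵢ = ∂₁ψ (DV e₀)ᵢ − ∂₀ψ (DV e₁)ᵢ` (`ω₂ = 0`). -/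
theorem convect_curl_self_apply (y : EuclideanSpace ℝ (Fin 3)) (i : Fin 3) :
    convect (curl V) V y i =
      fderiv ℝ (fun z => V z 2 - fderiv ℝ φ z (EuclideanSpace.single 2 1)) y (EuclideanSpace.single 1 1) *
          fderiv ℝ V y (EuclideanSpace.single 0 1) i -
        fderiv ℝ (fun z => V z 2 - fderiv ℝ φ z (EuclideanSpace.single 2 1)) y (EuclideanSpace.single 0 1) *
          fderiv ℝ V y (EuclideanSpace.single 1 1) i := by
  obtain ⟨h0, h1, h2⟩ := curl_apply_eq_fderiv_stream hV hcurl hφ y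
  rw [convect_apply, clm_apply_coord (fderiv ℝ V y) (curl V y) i, Fin.sum_univ_three, h0, h1, h2]
  ring

/-- **Diffusion term**: `(Δω)₀ = ∂₁Δψ`, `(Δω)₁ = −∂₀Δψ`. -/
theorem laplacian_curl_apply (y : EuclideanSpace ℝ (Fin 3)) :
    (Δ (curl V)) y 0 = fderiv ℝ (Δ (fun z => V z 2 - fderiv ℝ φ z (EuclideanSpace.single 2 1))) y
        (EuclideanSpace.single 1 1) ∧
    (Δ (curl V)) y 1 = -fderiv ℝ (Δ (fun z => V z 2 - fderiv ℝ φ z (EuclideanSpace.single 2 1))) y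
        (EuclideanSpace.single 0 1) := by
  set ψ : EuclideanSpace ℝ (Fin 3) → ℝ := fun z => V z 2 - fderiv ℝ φ z (EuclideanSpace.single 2 1) with hψ
  have hψs : ContDiff ℝ ∞ ψ := contDiff_stream hV hφ
  have hψ3 : ContDiff ℝ 3 ψ := hψs.of_le (by norm_cast)
  have hc2 : ContDiff ℝ (2 : ℕ∞) (curl V) := contDiff_curl (n := 2) (hV.of_le (by norm_cast))
  obtain ⟨hc0, hc1⟩ := curl_coord_fun hV hcurl hφ
  refine ⟨?_, ?_⟩
  · rw [laplacian_apply_coord hc2 y 0, hc0, fderiv_laplacian_apply hψ3]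
  · rw [laplacian_apply_coord hc2 y 1, hc1, fderiv_laplacian_apply hψ3]
    have hψ1 : ContDiff ℝ 2 (fun z => fderiv ℝ ψ z (EuclideanSpace.single 0 1)) :=
      (hψs.fderiv_right (m := 2) (by norm_cast)).clm_apply contDiff_const
    have : (fun y => -fderiv ℝ ψ y (EuclideanSpace.single 0 1)) = -(fun y => fderiv ℝ ψ y (EuclideanSpace.single 0 1)) := rfl
    rw [this, InnerProductSpace.laplacian_neg]
    rfl

/-- **Incompressibility in second-derivative form**: `∂₀∂₀φ + ∂₁∂₁φ = −(DV e₂)₂` (`Δ_h φ = −∂₂V₂`), from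
(E1) `Δφ + ∂₂ψ = 0` and `∂₂ψ = (DV e₂)₂ − ∂₂∂₂φ`. -/
theorem horizLaplacian_phi (hdiv : ∀ y, VectorCalculus.divergence V y = 0) (y : EuclideanSpace ℝ (Fin 3)) :
    fderiv ℝ (fun z => fderiv ℝ φ z (EuclideanSpace.single 0 1)) y (EuclideanSpace.single 0 1) +
      fderiv ℝ (fun z => fderiv ℝ φ z (EuclideanSpace.single 1 1)) y (EuclideanSpace.single 1 1) =
      -fderiv ℝ V y (EuclideanSpace.single 2 1) 2 := by
  have hφs := contDiff_phi hV hφ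
  have hE : VectorCalculus.divergence V y =
      (Δ φ) y + fderiv ℝ (fun z => V z 2 - fderiv ℝ φ z (EuclideanSpace.single 2 1)) y
        (EuclideanSpace.single 2 1) :=
    divergence_eq_laplacian_add_fderiv_stream hV hcurl hφ y
  rw [hdiv y, fderiv_stream_apply hV hφs,
    laplacian_eq_sum_fderiv_fderiv (EuclideanSpace.basisFun (Fin 3) ℝ) (hφs.of_le (by norm_cast)) y] at hE
  simp only [EuclideanSpace.basisFun_apply, Fin.sum_univ_three] at hE
  linarith

/-- **The horizontal vorticity operator in Clebsch variables (index 0).** For a smooth divergence-free field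
`V` with `(curl V)₂ ≡ 0`, horizontal line potential `φ` and stream function `ψ = V₂ − ∂₂φ`:
`((V·∇)ω − (ω·∇)V − Δω)₀ = ∂₁(V·∇ψ − Δψ) − (∂₂ψ · (DV e₁)₂ − (DV e₂)₂ · ∂₁ψ)` — the first coordinate of
`J[∇_h(V·∇ψ − Δψ) − ∂₂ψ ∇_h V₂ + ∂₂V₂ ∇_h ψ]`, `J(a₀,a₁) = (a₁, −a₀)` (cell ns-regularity-ideate, nsreg-p1
ROUND-8 §8 / R9-PREP (E2), derived by hand there; kernel-checked here). -/
theorem horizontalVorticityOperator_apply_zero (hdiv : ∀ y, VectorCalculus.divergence V y = 0)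
    (y : EuclideanSpace ℝ (Fin 3)) :
    convect V (curl V) y 0 - convect (curl V) V y 0 - (Δ (curl V)) y 0 =
      fderiv ℝ (fun z => convect V (fun z => V z 2 - fderiv ℝ φ z (EuclideanSpace.single 2 1)) z -
          (Δ (fun z => V z 2 - fderiv ℝ φ z (EuclideanSpace.single 2 1))) z) y (EuclideanSpace.single 1 1) -
        (fderiv ℝ (fun z => V z 2 - fderiv ℝ φ z (EuclideanSpace.single 2 1)) y (EuclideanSpace.single 2 1) *
            fderiv ℝ V y (EuclideanSpace.single 1 1) 2 -
          fderiv ℝ V y (EuclideanSpace.single 2 1) 2 *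
            fderiv ℝ (fun z => V z 2 - fderiv ℝ φ z (EuclideanSpace.single 2 1)) y (EuclideanSpace.single 1 1)) := by
  set ψ : EuclideanSpace ℝ (Fin 3) → ℝ := fun z => V z 2 - fderiv ℝ φ z (EuclideanSpace.single 2 1) with hψ
  have hψs : ContDiff ℝ ∞ ψ := contDiff_stream hV hφ
  have hφs := contDiff_phi hV hφ
  obtain ⟨ht0, -⟩ := convect_curl_apply hV hcurl hφ y
  have hs0 := convect_curl_self_apply hV hcurl hφ y 0
  obtain ⟨hl0, -⟩ := laplacian_curl_apply hV hcurl hφ y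
  -- `div V = (DV e₀)₀ + (DV e₁)₁ + (DV e₂)₂ = 0`
  have hdivsum : fderiv ℝ V y (EuclideanSpace.single 0 1) 0 + fderiv ℝ V y (EuclideanSpace.single 1 1) 1 +
      fderiv ℝ V y (EuclideanSpace.single 2 1) 2 = 0 := by
    have h := hdiv y
    rw [VectorCalculus.divergence, trace_eq_sum_coord, Fin.sum_univ_three] at h
    exact h
  -- expand `Dψ[DV e₁]` in coordinates
  have hexp : fderiv ℝ ψ y (fderiv ℝ V y (EuclideanSpace.single 1 1)) =
      fderiv ℝ V y (EuclideanSpace.single 1 1) 0 * fderiv ℝ ψ y (EuclideanSpace.single 0 1) +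
        fderiv ℝ V y (EuclideanSpace.single 1 1) 1 * fderiv ℝ ψ y (EuclideanSpace.single 1 1) +
        fderiv ℝ V y (EuclideanSpace.single 1 1) 2 * fderiv ℝ ψ y (EuclideanSpace.single 2 1) := by
    rw [clf_apply_eq_sum3 (fderiv ℝ ψ y), Fin.sum_univ_three]
  -- derivative of the difference
  have hdc : DifferentiableAt ℝ (fun z => convect V ψ z) y := by
    have : ContDiff ℝ ∞ fun z => convect V ψ z := (hψs.fderiv_right (m := ∞) le_rfl).clm_apply hV
    exact (this.differentiable (by simp)) y
  have hdl : DifferentiableAt ℝ (Δ ψ) y :=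
    ((contDiff_laplacian (n := 1) (hψs.of_le (by norm_cast))).differentiable (by simp)) y
  rw [fderiv_fun_sub hdc hdl, _root_.sub_apply, ht0, hs0, hl0, hexp]
  linear_combination (-(fderiv ℝ ψ y (EuclideanSpace.single 1 1))) * hdivsum

/-- **The horizontal vorticity operator in Clebsch variables (index 1).**
`((V·∇)ω − (ω·∇)V − Δω)₁ = −∂₀(V·∇ψ − Δψ) + (∂₂ψ · (DV e₀)₂ − (DV e₂)₂ · ∂₀ψ)`. -/
theorem horizontalVorticityOperator_apply_one (hdiv : ∀ y, VectorCalculus.divergence V y = 0)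
    (y : EuclideanSpace ℝ (Fin 3)) :
    convect V (curl V) y 1 - convect (curl V) V y 1 - (Δ (curl V)) y 1 =
      -fderiv ℝ (fun z => convect V (fun z => V z 2 - fderiv ℝ φ z (EuclideanSpace.single 2 1)) z -
          (Δ (fun z => V z 2 - fderiv ℝ φ z (EuclideanSpace.single 2 1))) z) y (EuclideanSpace.single 0 1) +
        (fderiv ℝ (fun z => V z 2 - fderiv ℝ φ z (EuclideanSpace.single 2 1)) y (EuclideanSpace.single 2 1) *
            fderiv ℝ V y (EuclideanSpace.single 0 1) 2 -
          fderiv ℝ V y (EuclideanSpace.single 2 1) 2 *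
            fderiv ℝ (fun z => V z 2 - fderiv ℝ φ z (EuclideanSpace.single 2 1)) y (EuclideanSpace.single 0 1)) := by
  set ψ : EuclideanSpace ℝ (Fin 3) → ℝ := fun z => V z 2 - fderiv ℝ φ z (EuclideanSpace.single 2 1) with hψ
  have hψs : ContDiff ℝ ∞ ψ := contDiff_stream hV hφ
  obtain ⟨-, ht1⟩ := convect_curl_apply hV hcurl hφ y
  have hs1 := convect_curl_self_apply hV hcurl hφ y 1
  obtain ⟨-, hl1⟩ := laplacian_curl_apply hV hcurl hφ y
  have hdivsum : fderiv ℝ V y (EuclideanSpace.single 0 1) 0 + fderiv ℝ V y (EuclideanSpace.single 1 1) 1 +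
      fderiv ℝ V y (EuclideanSpace.single 2 1) 2 = 0 := by
    have h := hdiv y
    rw [VectorCalculus.divergence, trace_eq_sum_coord, Fin.sum_univ_three] at h
    exact h
  have hexp : fderiv ℝ ψ y (fderiv ℝ V y (EuclideanSpace.single 0 1)) =
      fderiv ℝ V y (EuclideanSpace.single 0 1) 0 * fderiv ℝ ψ y (EuclideanSpace.single 0 1) +
        fderiv ℝ V y (EuclideanSpace.single 0 1) 1 * fderiv ℝ ψ y (EuclideanSpace.single 1 1) +
        fderiv ℝ V y (EuclideanSpace.single 0 1) 2 * fderiv ℝ ψ y (EuclideanSpace.single 2 1) := by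
    rw [clf_apply_eq_sum3 (fderiv ℝ ψ y), Fin.sum_univ_three]
  -- symmetry of the horizontal block: `(DV e₀)₁ = (DV e₁)₀` (vanishing vertical vorticity)
  have hsym : fderiv ℝ V y (EuclideanSpace.single 0 1) 1 = fderiv ℝ V y (EuclideanSpace.single 1 1) 0 := by
    have h := hcurl y
    have : curl V y 2 = fderiv ℝ V y (EuclideanSpace.single 0 1) 1 - fderiv ℝ V y (EuclideanSpace.single 1 1) 0 := by
      simp [curl]
    rw [this] at h
    linarith
  have hdc : DifferentiableAt ℝ (fun z => convect V ψ z) y := by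
    have : ContDiff ℝ ∞ fun z => convect V ψ z := (hψs.fderiv_right (m := ∞) le_rfl).clm_apply hV
    exact (this.differentiable (by simp)) y
  have hdl : DifferentiableAt ℝ (Δ ψ) y :=
    ((contDiff_laplacian (n := 1) (hψs.of_le (by norm_cast))).differentiable (by simp)) y
  rw [fderiv_fun_sub hdc hdl, _root_.sub_apply, ht1, hs1, hl1, hexp, hsym]
  linear_combination (fderiv ℝ ψ y (EuclideanSpace.single 0 1)) * hdivsum

end Clebsch


/-! ### The class version: (E2) for poloidal Type-I profiles -/
section Profile

open Summit.NavierStokesRegularity.NavierStokesRegularity.Theorems.LocalSineTubeDoorProfileAlignedWindowRigidityAncient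
open MeasureTheory Filter Topology

variable {C : ℝ} {v : ℝ → EuclideanSpace ℝ (Fin 3) → EuclideanSpace ℝ (Fin 3)}

/-- The route's profile class lies in the tree's `IsTypeIAncientMild` (joint real-analyticity of Oseen-ancient
fields; port of the cell bridge, cf. seat p6's `isTypeIAncientMild_of_class`). -/
theorem isTypeIAncientMild_of_profile (hrate : HasTypeITimeDecay C v)
    (hcont : ContinuousOn (uncurry v) (Iio (0 : ℝ) ×ˢ univ))
    (hmild : ∀ s t : ℝ, s < t → t < 0 → ∀ x,
      v t x = UnboundedOperators.heatExtension (v s) (t - s) x - oseenDuhamel 1 s v v t x)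
    (hdiv : ∀ t < 0, VectorCalculus.IsDivFree (v t)) : IsTypeIAncientMild C v := by
  refine ⟨(analyticOnNhd_uncurry hcont (bdd_of_hasTypeITimeDecay hrate) hmild).contDiffOn_of_completeSpace,
    fun t ht => hdiv t ht, fun s t hst ht x => ?_, hrate⟩
  rw [heatFlow_of_pos _ (sub_pos.2 hst)]
  exact hmild s t hst ht x

/-- **(E2) — the horizontal vorticity equation of a poloidal Type-I profile in Clebsch variables.** Under the
hypotheses of `stub_nonflatLiouville` (class + poloidality along `e₂`), for every `t < 0`, with `φ` the horizontal
line potential of the slice `v t` and `ψ = (v t)₂ − ∂₂φ` (so `curl (v t) = ∇ψ × e₂`):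
`(curl ∂ₜv)₀ + ∂₁((v·∇)ψ − Δψ) = ∂₂ψ ∂₁v₂ − ∂₂v₂ ∂₁ψ` and
`(curl ∂ₜv)₁ − ∂₀((v·∇)ψ − Δψ) = −(∂₂ψ ∂₀v₂ − ∂₂v₂ ∂₀ψ)` — i.e. with `T := ∂ₜψ + v·∇ψ − Δψ` (and
`curl ∂ₜv = ∇(∂ₜψ) × e₂`), `∇_h T = ∂₂ψ ∇_h v₂ − ∂₂v₂ ∇_h ψ` (nsreg-p1 R9-PREP §(1), (E2)). The time derivative
is the two-sided one (`deriv`); the vorticity equation is the tree's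
`IsClassicalNSSolutionOn.curl_timeDerivWithin_eq` for the classical solution (with pressure) that a Type-I ancient
mild field is on every window (`IsTypeIAncientMild.exists_isClassicalNSSolutionOn_Ioo`). -/
theorem clebsch_vorticity_equation (hrate : HasTypeITimeDecay C v)
    (hcont : ContinuousOn (uncurry v) (Iio (0 : ℝ) ×ˢ univ))
    (hmild : ∀ s t : ℝ, s < t → t < 0 → ∀ x,
      v t x = UnboundedOperators.heatExtension (v s) (t - s) x - oseenDuhamel 1 s v v t x)
    (hdiv : ∀ t < 0, VectorCalculus.IsDivFree (v t))
    (hpol : ∀ s < 0, ∀ y, ⟪curl (v s) y, EuclideanSpace.single 2 1⟫_ℝ = 0)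
    {t : ℝ} (ht : t < 0) {φ : EuclideanSpace ℝ (Fin 3) → ℝ}
    (hφ : φ = fun x : EuclideanSpace ℝ (Fin 3) =>
      ∫ σ in (0 : ℝ)..1, ⟪v t (σ • (x - x 2 • (EuclideanSpace.single (2 : Fin 3) (1 : ℝ))) +
        x 2 • (EuclideanSpace.single (2 : Fin 3) (1 : ℝ))),
        x - x 2 • (EuclideanSpace.single (2 : Fin 3) (1 : ℝ))⟫_ℝ)
    (y : EuclideanSpace ℝ (Fin 3)) :
    curl (fun z => deriv (fun s => v s z) t) y 0 +
        fderiv ℝ (fun z => convect (v t) (fun z => v t z 2 - fderiv ℝ φ z (EuclideanSpace.single 2 1)) z -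
          (Δ (fun z => v t z 2 - fderiv ℝ φ z (EuclideanSpace.single 2 1))) z) y (EuclideanSpace.single 1 1) =
      fderiv ℝ (fun z => v t z 2 - fderiv ℝ φ z (EuclideanSpace.single 2 1)) y (EuclideanSpace.single 2 1) *
          fderiv ℝ (v t) y (EuclideanSpace.single 1 1) 2 -
        fderiv ℝ (v t) y (EuclideanSpace.single 2 1) 2 *
          fderiv ℝ (fun z => v t z 2 - fderiv ℝ φ z (EuclideanSpace.single 2 1)) y (EuclideanSpace.single 1 1) ∧
    curl (fun z => deriv (fun s => v s z) t) y 1 -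
        fderiv ℝ (fun z => convect (v t) (fun z => v t z 2 - fderiv ℝ φ z (EuclideanSpace.single 2 1)) z -
          (Δ (fun z => v t z 2 - fderiv ℝ φ z (EuclideanSpace.single 2 1))) z) y (EuclideanSpace.single 0 1) =
      -(fderiv ℝ (fun z => v t z 2 - fderiv ℝ φ z (EuclideanSpace.single 2 1)) y (EuclideanSpace.single 2 1) *
          fderiv ℝ (v t) y (EuclideanSpace.single 0 1) 2 -
        fderiv ℝ (v t) y (EuclideanSpace.single 2 1) 2 *
          fderiv ℝ (fun z => v t z 2 - fderiv ℝ φ z (EuclideanSpace.single 2 1)) y (EuclideanSpace.single 0 1)) := by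
  have hA : IsTypeIAncientMild C v := isTypeIAncientMild_of_profile hrate hcont hmild hdiv
  have ht2 : 2 * t < 0 := by linarith
  have htI : t ∈ Ioo (2 * t) 0 := ⟨by linarith, ht⟩
  obtain ⟨p, hNS⟩ := hA.exists_isClassicalNSSolutionOn_Ioo ht2
  have hvort := hNS.curl_timeDerivWithin_eq isOpen_Ioo.uniqueDiffOn htI y
  -- the within-derivative on the open window is the two-sided derivative
  have hder : timeDerivWithin (Ioo (2 * t) 0) v t = fun z => deriv (fun s => v s z) t := by
    funext z
    rw [timeDerivWithin_apply, derivWithin_of_isOpen isOpen_Ioo htI]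
  have hf0 : curl ((0 : ℝ → EuclideanSpace ℝ (Fin 3) → EuclideanSpace ℝ (Fin 3)) t) y = 0 := by
    have : ((0 : ℝ → EuclideanSpace ℝ (Fin 3) → EuclideanSpace ℝ (Fin 3)) t) =
        fun _ => (0 : EuclideanSpace ℝ (Fin 3)) := rfl
    rw [this]
    ext i
    fin_cases i <;> simp [curl]
  rw [hder, hf0, one_smul, add_zero] at hvort
  -- the slice is smooth, divergence-free and vertically curl-free
  have hV : ContDiff ℝ ∞ (v t) :=
    contDiffOn_univ.1 (analyticOnNhd_slice hcont (bdd_of_hasTypeITimeDecay hrate) hmild ht).contDiffOn_of_completeSpace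
  have hc2 : ∀ z, curl (v t) z 2 = 0 := fun z => by
    have h := hpol t ht z
    simp only [EuclideanSpace.inner_single_right, one_mul, conj_trivial] at h
    exact h
  have hdv : ∀ z, VectorCalculus.divergence (v t) z = 0 := fun z => hdiv t ht z
  have h0 := horizontalVorticityOperator_apply_zero hV hc2 hφ hdv y
  have h1 := horizontalVorticityOperator_apply_one hV hc2 hφ hdv y
  have e0 := congrArg (fun w : EuclideanSpace ℝ (Fin 3) => w 0) hvort
  have e1 := congrArg (fun w : EuclideanSpace ℝ (Fin 3) => w 1) hvort
  simp only [PiLp.add_apply, PiLp.sub_apply] at e0 e1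
  constructor
  · linarith
  · linarith

end Profile
end Summit.NavierStokesRegularity.NavierStokesRegularity.Theorems.PoloidalWindowDoorPoloidalWindowRigidityClebschVorticity

end
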